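import Literature.Probability.Moments.EfronSteinProofs
import HarnessLib

/-!
# Variance of functions with bounded differences and of weighted pair sums

Topic `Literature/Probability/Moments` (kind proof; no new notions).  Two corollaries of the
Efron–Stein inequality (`EfronSteinInequality_holds`, Boucheron–Bousquet–Lugosi 2004, §2 Thm 5) for
functions of finitely many independent random variables, realised as the coordinates of a finite
product probability space:

* `variance_le_of_bounded_differences` — if replacing one coordinate changes `g` by at most `cᵢ`
  (McDiarmid's bounded-difference condition) and `g` is measurable and bounded, then
  `Var g ≤ ½ Σᵢ cᵢ²` (BBL 2004, §2, Corollary of Thm 5 / "bounded differences").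
* `variance_weightedPairSum_le` — for i.i.d. coordinates, a bounded measurable pair kernel
  `|Θ| ≤ C` and deterministic weights `|w a b| ≤ W`, the weighted pair sum (a non-symmetric
  `U`-statistic of order `2`) `g(v) = Σ_a Σ_b w a b · Θ(v_a, v_b)` has
  `Var g ≤ 8 n³ W² C²`, `n` the number of coordinates: replacing coordinate `i` only moves the
  `2n − 1` terms with `a = i` or `b = i`, each by at most `2 W C`.  With the normalisation
  `W = O(n⁻²)` of an empirical pair average this is the classical `O(1/n)` variance of a
  `U`-statistic with bounded kernel (Hoeffding 1948).

## References

* S. Boucheron, O. Bousquet, G. Lugosi, *Concentration Inequalities*, in: Advanced Lectures on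
  Machine Learning, LNCS 3176, Springer 2004, §2 (Efron–Stein; bounded differences).
  [BoucheronBousquetLugosi2004]
* W. Hoeffding, *A class of statistics with asymptotically normal distribution*, Ann. Math.
  Statist. 19 (1948) 293–325, §5 (variance of a `U`-statistic). [folklore]
-/

noncomputable section

open MeasureTheory ProbabilityTheory

namespace Literature.Probability.Moments

universe u v

/-- **Bounded differences bound the variance** (corollary of the Efron–Stein inequality): on a
finite product probability space, if `g` is measurable, bounded, and
`|g x − g (x with xᵢ := y)| ≤ cᵢ` for all `x, y, i`, then `Var g ≤ ½ Σᵢ cᵢ²`.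
[cite: BoucheronBousquetLugosi2004, §2 Thm 5] -/
theorem variance_le_of_bounded_differences {ι : Type u} [Fintype ι] [DecidableEq ι]
    {Ω : ι → Type v} [∀ i, MeasurableSpace (Ω i)] (μ : (i : ι) → Measure (Ω i))
    [∀ i, IsProbabilityMeasure (μ i)] {g : ((i : ι) → Ω i) → ℝ} (hg : Measurable g)
    {B : ℝ} (hB : ∀ x, |g x| ≤ B) {c : ι → ℝ}
    (hc : ∀ i x y, |g x - g (Function.update x i y)| ≤ c i) :
    variance g (Measure.pi μ) ≤ (1 / 2 : ℝ) * ∑ i, c i ^ 2 := by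
  have hmem : MemLp g 2 (Measure.pi μ) :=
    memLp_of_bounded (a := -B) (b := B) (Filter.Eventually.of_forall fun x => abs_le.1 (hB x))
      hg.aestronglyMeasurable 2
  refine (EfronSteinInequality_holds ι Ω μ g hg hmem).trans
    (mul_le_mul_of_nonneg_left (Finset.sum_le_sum fun i _ => ?_) (by norm_num))
  have hin : ∀ x, ∫ y, (g x - g (Function.update x i y)) ^ 2 ∂μ i ≤ c i ^ 2 := fun x => by
    calc ∫ y, (g x - g (Function.update x i y)) ^ 2 ∂μ i ≤ ∫ _y, c i ^ 2 ∂μ i :=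
          integral_mono_of_nonneg (Filter.Eventually.of_forall fun y => sq_nonneg _)
            (integrable_const _) (Filter.Eventually.of_forall fun y => by
              have h := hc i x y
              dsimp only
              rw [← sq_abs]
              exact pow_le_pow_left₀ (abs_nonneg _) h 2)
      _ = c i ^ 2 := by rw [integral_const, smul_eq_mul, probReal_univ, one_mul]
  calc ∫ x, ∫ y, (g x - g (Function.update x i y)) ^ 2 ∂μ i ∂Measure.pi μ
      ≤ ∫ _x, c i ^ 2 ∂Measure.pi μ :=
        integral_mono_of_nonneg
          (Filter.Eventually.of_forall fun x => integral_nonneg fun y => sq_nonneg _)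
          (integrable_const _) (Filter.Eventually.of_forall hin)
    _ = c i ^ 2 := by rw [integral_const, smul_eq_mul, probReal_univ, one_mul]

/-- **Variance of a weighted pair sum of i.i.d. coordinates** (order-`2` `U`-statistic with a
bounded kernel and bounded deterministic weights): for `g(v) = Σ_a Σ_b w a b · Θ(v_a, v_b)` with
`|Θ| ≤ C`, `|w a b| ≤ W`, under `γ^{⊗ι}`, `Var g ≤ 8 n³ W² C²` (`n = |ι|`).  Replacing coordinate
`i` changes only the terms with `a = i` or `b = i` (at most `2n` of them), each by at most `2WC`,
so the bounded-difference constants are `cᵢ = 4 n W C`. [folklore] -/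
theorem variance_weightedPairSum_le {ι : Type u} [Fintype ι] [DecidableEq ι] {X : Type v}
    [MeasurableSpace X] (γ : Measure X) [IsProbabilityMeasure γ]
    {Θ : X × X → ℝ} (hΘ : Measurable Θ) {C : ℝ} (hC : ∀ p, |Θ p| ≤ C)
    {w : ι → ι → ℝ} {W : ℝ} (hw : ∀ a b, |w a b| ≤ W) :
    variance (fun v : ι → X => ∑ a, ∑ b, w a b * Θ (v a, v b)) (Measure.pi fun _ : ι => γ) ≤
      8 * (Fintype.card ι : ℝ) ^ 3 * W ^ 2 * C ^ 2 := by
  set n : ℕ := Fintype.card ι with hn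
  set g : (ι → X) → ℝ := fun v => ∑ a, ∑ b, w a b * Θ (v a, v b) with hg
  have hgm : Measurable g := by
    refine Finset.measurable_sum _ fun a _ => Finset.measurable_sum _ fun b _ => ?_
    exact (hΘ.comp ((measurable_pi_apply a).prodMk (measurable_pi_apply b))).const_mul _
  -- the term bound
  have hterm : ∀ (v : ι → X) (a b : ι), |w a b * Θ (v a, v b)| ≤ W * C := fun v a b => by
    rw [abs_mul]
    exact mul_le_mul (hw a b) (hC _) (abs_nonneg _) ((abs_nonneg _).trans (hw a b))
  have hB : ∀ v, |g v| ≤ n * (n * (W * C)) := fun v => by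
    refine (Finset.abs_sum_le_sum_abs _ _).trans ?_
    calc ∑ a, |∑ b, w a b * Θ (v a, v b)| ≤ ∑ _a : ι, (n * (W * C)) :=
          Finset.sum_le_sum fun a _ => (Finset.abs_sum_le_sum_abs _ _).trans
            ((Finset.sum_le_sum fun b _ => hterm v a b).trans (by
              rw [Finset.sum_const, Finset.card_univ, nsmul_eq_mul]))
      _ = n * (n * (W * C)) := by rw [Finset.sum_const, Finset.card_univ, nsmul_eq_mul]
  -- bounded differences with constant `4 n W C`
  have hdiff : ∀ (i : ι) (v : ι → X) (y : X),
      |g v - g (Function.update v i y)| ≤ 4 * n * W * C := by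
    intro i v y
    set v' := Function.update v i y with hv'
    have e : g v - g v' = ∑ a, ∑ b, w a b * (Θ (v a, v b) - Θ (v' a, v' b)) := by
      simp only [hg, mul_sub, Finset.sum_sub_distrib]
    have hpt : ∀ a b : ι, |w a b * (Θ (v a, v b) - Θ (v' a, v' b))| ≤
        2 * W * C * ((if a = i then 1 else 0) + (if b = i then 1 else 0)) := by
      intro a b
      by_cases hab : a = i ∨ b = i
      · have h1 : (1 : ℝ) ≤ (if a = i then 1 else 0) + (if b = i then 1 else 0) := by
          rcases hab with ha | hb
          · rw [if_pos ha]; split_ifs <;> norm_num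
          · rw [if_pos hb]; split_ifs <;> norm_num
        have h2 : |w a b * (Θ (v a, v b) - Θ (v' a, v' b))| ≤ 2 * W * C := by
          rw [abs_mul]
          calc |w a b| * |Θ (v a, v b) - Θ (v' a, v' b)| ≤ W * (C + C) :=
                mul_le_mul (hw a b) ((abs_sub _ _).trans (add_le_add (hC _) (hC _)))
                  (abs_nonneg _) ((abs_nonneg _).trans (hw a b))
            _ = 2 * W * C := by ring
        have h0 : 0 ≤ 2 * W * C := (abs_nonneg _).trans h2
        calc |w a b * (Θ (v a, v b) - Θ (v' a, v' b))| ≤ 2 * W * C * 1 := by rw [mul_one]; exact h2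
          _ ≤ 2 * W * C * ((if a = i then 1 else 0) + (if b = i then 1 else 0)) :=
              mul_le_mul_of_nonneg_left h1 h0
      · push Not at hab
        have ha : v' a = v a := by rw [hv', Function.update_of_ne hab.1]
        have hb : v' b = v b := by rw [hv', Function.update_of_ne hab.2]
        rw [ha, hb, sub_self, mul_zero, abs_zero]
        have hWC : 0 ≤ W * C := (abs_nonneg _).trans (hterm v a b)
        refine mul_nonneg (by nlinarith) (add_nonneg ?_ ?_)
        · split_ifs <;> norm_num
        · split_ifs <;> norm_num
    have hcount : ∑ a : ι, ∑ b : ι, ((if a = i then (1 : ℝ) else 0) + (if b = i then 1 else 0)) =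
        2 * n := by
      simp only [Finset.sum_add_distrib, Finset.sum_const, Finset.card_univ, nsmul_eq_mul,
        Finset.sum_ite_eq', Finset.mem_univ, if_true, mul_ite, mul_one, mul_zero, hn]
      ring
    rw [e]
    calc |∑ a, ∑ b, w a b * (Θ (v a, v b) - Θ (v' a, v' b))|
        ≤ ∑ a, ∑ b, |w a b * (Θ (v a, v b) - Θ (v' a, v' b))| :=
          (Finset.abs_sum_le_sum_abs _ _).trans
            (Finset.sum_le_sum fun a _ => Finset.abs_sum_le_sum_abs _ _)
      _ ≤ ∑ a, ∑ b, 2 * W * C * ((if a = i then 1 else 0) + (if b = i then 1 else 0)) :=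
          Finset.sum_le_sum fun a _ => Finset.sum_le_sum fun b _ => hpt a b
      _ = 2 * W * C * (2 * n) := by
          rw [← hcount, Finset.mul_sum]
          exact Finset.sum_congr rfl fun a _ => by rw [Finset.mul_sum]
      _ = 4 * n * W * C := by ring
  calc variance g (Measure.pi fun _ : ι => γ)
      ≤ (1 / 2 : ℝ) * ∑ _i : ι, (4 * n * W * C) ^ 2 :=
        variance_le_of_bounded_differences (fun _ : ι => γ) hgm hB hdiff
    _ = 8 * (n : ℝ) ^ 3 * W ^ 2 * C ^ 2 := by
        rw [Finset.sum_const, Finset.card_univ, nsmul_eq_mul, ← hn]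
        ring

end Literature.Probability.Moments

end
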